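import Literature.NumberTheory.Sieve.FGKMT2018LocalPairSumTotal
import HarnessLib

/-!
# FGKMT 2018 Theorem 6 / Maynard 2016 Prop. 9.1: the main term regrouped as `∑_r y_r²/φ_ω(r)`

Sources: J. Maynard, *Dense clusters of primes in subsets*, Compositio Math. 152 (2016) =
arXiv:1405.2593 [Maynard2016DenseClusters], proof of Proposition 9.1 pp. 19–20: after (9.5) one
writes `y_s = y_r + (y_s − y_r)` («By Lemma 8.3, for each such choice we have
`y_s = y_r + O(T_k (Y_r + Y_s) log A / log R)`») and the main term becomes
`(#𝒜(x)/W) ∑_{r ∈ 𝒟_k} y_r²/φ_ω(r)` (display before «We estimate the inner sum here by applying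
Lemma 8.4»); K. Ford, B. Green, S. Konyagin, J. Maynard, T. Tao, *Long gaps between primes*,
JAMS 31 (2018) = arXiv:1412.5029v4 [FordGreenKonyaginMaynardTao2018], Theorem 6 (i) p. 21.

PROVED here (no named facts), combining `FGKMT2018DkBoxClasses` (step (9.1)),
`FGKMT2018QuadFormSwap` ((9.2)), `FGKMT2018LocalPairSumVanishing`/`…Peel` ((9.5)) and
`FGKMT2018LocalPairSumTotal` (`∑_s T(r,s) = φ_ω(r)`):

* `yVar_eq_zero_of_floor_lt` — `y_r = 0` unless `∏rᵢ ≤ ⌊R⌋` (support of `F` in the simplex);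
* **`sum_yVar_mul_localPairSum_eq`**, **`quadForm_regroup`** — the exact identity
  `∑_{r,s} y_r y_s T(r,s)/(φ_ω(r)φ_ω(s)) = ∑_r y_r²/φ_ω(r) + ∑_{r,s} y_r (y_s − y_r) T(r,s)/φ_ω(r)²`;
* **`abs_sum_sieveWt_sub_mainSum_le`** — hence
  `|∑_{n ∈ 𝒜(X)} w_n − #𝒜(X) (φ_ω(W)/W) (∑_r y_r²/φ_ω(r) + E_diff)| ≤ φ_ω(W) (∑_d |λ_d|)²`
  with `E_diff` the `y`-difference double sum. What remains of Proposition 9.1 for `𝒜 = ℤ` is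
  analytic: `E_diff` is small by Maynard's Lemma 8.3 (`y_s − y_r ≪ T_k(Y_r+Y_s) log A/log R`) and
  `∑_r y_r²/φ_ω(r)` is evaluated by Lemma 8.4 ((9.4)); `∑_d|λ_d| ≤ λ_max R(1+log R)^k` with
  `λ_max ≪ y_max log^k R` (Lemma 8.5 (i)).

## References
* J. Maynard, *Dense clusters of primes in subsets*, Compositio Math. 152 (2016), Prop. 9.1
  [Maynard2016DenseClusters].
* K. Ford, B. Green, S. Konyagin, J. Maynard, T. Tao, *Long gaps between primes*, JAMS 31 (2018),
  Theorem 6 [FordGreenKonyaginMaynardTao2018].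
-/

noncomputable section

open Finset
open scoped ArithmeticFunction.Moebius

namespace Literature.NumberTheory.Sieve.FGKMT2018

variable {k : ℕ}

/-- `y_r = 0` unless `∏ rᵢ ≤ ⌊R⌋` (`F` is cut to the simplex `∑ tᵢ ≤ 1`, `tᵢ = log rᵢ/log R`).
[cite: Maynard2016DenseClusters, §7 p. 13 (support of F, y_r)] -/
theorem yVar_eq_zero_of_floor_lt {L : Fin k → ℤ × ℤ} {B : ℕ} {R : ℝ} {F : (Fin k → ℝ) → ℝ}
    {r : Fin k → ℕ} (hR : 1 < R) (hr1 : ∀ i, 1 ≤ r i) (h : ⌊R⌋₊ < ∏ i, r i) :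
    yVar L B R F r = 0 := by
  have hlogR : 0 < Real.log R := Real.log_pos hR
  have hRlt : R < ∏ i, (r i : ℝ) := by
    have := Nat.lt_of_floor_lt h
    push_cast at this
    exact this
  have hr0 : ∀ i, (r i : ℝ) ≠ 0 := fun i => by exact_mod_cast Nat.one_le_iff_ne_zero.1 (hr1 i)
  have hnot : (fun i => Real.log (r i) / Real.log R) ∉ maynardSimplex k := by
    intro hmem
    unfold maynardSimplex at hmem
    rw [Set.mem_setOf_eq] at hmem
    obtain ⟨-, hsum⟩ := hmem
    rw [← Finset.sum_div, div_le_one hlogR, ← Real.log_prod (fun i _ => hr0 i)] at hsum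
    have hlt := Real.log_lt_log (by linarith) hRlt
    linarith
  unfold yVar
  rw [Set.indicator_of_notMem hnot, mul_zero]

/-- **The main term regrouped, one `r` at a time**: for `r ∈ 𝒟_k(𝓛)`,
`∑_s y_r y_s T(r,s)/(φ_ω(r)φ_ω(s)) = y_r²/φ_ω(r) + ∑_s y_r (y_s − y_r) T(r,s)/φ_ω(r)²`
(`T(r,s) ≠ 0` forces `∏s = ∏r`, so `φ_ω(s) = φ_ω(r)`, and `∑_s T(r,s) = φ_ω(r)`).
[cite: Maynard2016DenseClusters, proof of Prop. 9.1 pp. 19–20] -/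
theorem sum_yVar_mul_localPairSum_eq {L : Fin k → ℤ × ℤ} (hadm : FormsAdmissible L) {B : ℕ} {R : ℝ}
    (hR : 1 < R) (F : (Fin k → ℝ) → ℝ) {r : Fin k → ℕ} (hr : r ∈ dkBox L B R) :
    ∑ s ∈ dkBox L B R, yVar L B R F r * yVar L B R F s /
        (phiOmega L (∏ i, r i) * phiOmega L (∏ i, s i)) * localPairSum L B R r s =
      yVar L B R F r ^ 2 / phiOmega L (∏ i, r i) +
        ∑ s ∈ dkBox L B R, yVar L B R F r * (yVar L B R F s - yVar L B R F r) /
          phiOmega L (∏ i, r i) ^ 2 * localPairSum L B R r s := by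
  classical
  by_cases hbig : ⌊R⌋₊ < ∏ i, r i
  · have hy : yVar L B R F r = 0 := yVar_eq_zero_of_floor_lt hR (one_le_of_mem_dkBox hr) hbig
    simp [hy]
  · have hT := sum_localPairSum_eq_phiOmega hadm hr (not_lt.1 hbig)
    have hterm : ∀ s ∈ dkBox L B R,
        yVar L B R F r * yVar L B R F s / (phiOmega L (∏ i, r i) * phiOmega L (∏ i, s i)) *
            localPairSum L B R r s =
          yVar L B R F r ^ 2 / phiOmega L (∏ i, r i) ^ 2 * localPairSum L B R r s +
            yVar L B R F r * (yVar L B R F s - yVar L B R F r) / phiOmega L (∏ i, r i) ^ 2 *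
              localPairSum L B R r s := by
      intro s hs
      by_cases hT0 : localPairSum L B R r s = 0
      · simp [hT0]
      · have heq : (∏ i, s i) = ∏ i, r i := by
          by_contra hne
          exact hT0 (localPairSum_eq_zero_of_prod_ne hr hs (fun h => hne h.symm))
        rw [heq]
        ring
    rw [Finset.sum_congr rfl hterm, Finset.sum_add_distrib, ← Finset.mul_sum, hT]
    congr 1
    by_cases hφ : phiOmega L (∏ i, r i) = 0
    · simp [hφ]
    · rw [show phiOmega L (∏ i, r i) ^ 2 = phiOmega L (∏ i, r i) * phiOmega L (∏ i, r i) from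
        pow_two _, ← div_div, div_mul_cancel₀ _ hφ]

/-- **Maynard's main-term regrouping** (exact form):
`∑_{r,s ∈ 𝒟_k} y_r y_s T(r,s)/(φ_ω(r)φ_ω(s)) = ∑_r y_r²/φ_ω(r) + ∑_{r,s} y_r (y_s − y_r) T(r,s)/φ_ω(r)²`.
[cite: Maynard2016DenseClusters, proof of Prop. 9.1 pp. 19–20] -/
theorem quadForm_regroup {L : Fin k → ℤ × ℤ} (hadm : FormsAdmissible L) {B : ℕ} {R : ℝ} (hR : 1 < R)
    (F : (Fin k → ℝ) → ℝ) :
    ∑ r ∈ dkBox L B R, ∑ s ∈ dkBox L B R, yVar L B R F r * yVar L B R F s /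
        (phiOmega L (∏ i, r i) * phiOmega L (∏ i, s i)) * localPairSum L B R r s =
      ∑ r ∈ dkBox L B R, yVar L B R F r ^ 2 / phiOmega L (∏ i, r i) +
        ∑ r ∈ dkBox L B R, ∑ s ∈ dkBox L B R, yVar L B R F r * (yVar L B R F s - yVar L B R F r) /
          phiOmega L (∏ i, r i) ^ 2 * localPairSum L B R r s := by
  rw [← Finset.sum_add_distrib]
  exact Finset.sum_congr rfl fun r hr => sum_yVar_mul_localPairSum_eq hadm hR F hr

/-- **Proposition 9.1 for `𝒜 = ℤ`, algebraic part complete**: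
`|∑_{n ∈ 𝒜(X)} w_n − #𝒜(X)·(φ_ω(W)/W)·(∑_r y_r²/φ_ω(r) + E_diff)| ≤ φ_ω(W) (∑_d |λ_d|)²`, where
`E_diff = ∑_{r,s} y_r (y_s − y_r) T(r,s)/φ_ω(r)²` (to be bounded with Maynard's Lemma 8.3) and
`∑_r y_r²/φ_ω(r)` is the sum of Lemma 8.4 / (9.4).
[cite: Maynard2016DenseClusters, proof of Prop. 9.1 pp. 19–20; FordGreenKonyaginMaynardTao2018, Theorem 6 (i) p. 21] -/
theorem abs_sum_sieveWt_sub_mainSum_le (X : ℝ) {L : Fin k → ℤ × ℤ} (hadm : FormsAdmissible L)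
    (B : ℕ) {R : ℝ} (hR : 1 < R) (F : (Fin k → ℝ) → ℝ) :
    |∑ n ∈ dyadZ X, sieveWt L B R F n -
        (#(dyadZ X) : ℝ) * phiOmega L (wCut k B) / (wCut k B : ℝ) *
          (∑ r ∈ dkBox L B R, yVar L B R F r ^ 2 / phiOmega L (∏ i, r i) +
            ∑ r ∈ dkBox L B R, ∑ s ∈ dkBox L B R,
              yVar L B R F r * (yVar L B R F s - yVar L B R F r) / phiOmega L (∏ i, r i) ^ 2 *
                localPairSum L B R r s)|
      ≤ phiOmega L (wCut k B) * (∑ d ∈ dkBox L B R, |lamVar L B R F d|) ^ 2 := by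
  have h := abs_sum_sieveWt_sub_quadForm_le X hadm B R F
  rw [quadForm_eq_sum_yVar, quadForm_regroup hadm hR F] at h
  exact h

end Literature.NumberTheory.Sieve.FGKMT2018
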